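import Summits.QuantumFields.YangMills.Theorems.FluctuationComparisonRegPrIntLBackgroundFormCellResponseKnit
import Summits.QuantumFields.YangMills.Theorems.FluctuationComparisonRegPrIntLBackgroundFormCellGasKnit
import Summits.QuantumFields.YangMills.Theorems.FluctuationComparisonRegPrIntLBackgroundFormCellAnalyticKnit
import HarnessLib

/-!
# THE v2 CONE END TO END FROM THE RESPONSE LEAF: RESPᵃ∘ ⇒ BGFORMᵃ∘ v2 ⇒ S2β ∕ GRAD∘ (compositions, texts inline, def-free)

Cell `ym3-torus` (YM ladder rung R3 = continuum `SU(2)` Yang–Mills on the three-torus — a RUNG, NOT d = 4, NOT infinite volume, NOT a mass gap, NOT Clay).  Width seat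
`ym-ust-20520-w5` (gen 20); `--supports stmt-QuantumFields-20520 --as helper`, count-neutral, definition-free (row texts INLINE), default heartbeats.

WHAT.  Three compositions over landed files of LINE g24-4's v2 cone: this seat's ✓`…CellResponseKnit` (`backgroundFormCellGas_of_response : RESPᵃ∘ → GASᵇᵍ∘ v2`),
LEAD w3-20520 g21's ✓`…CellGasKnit` (`backgroundFormCellAnalytic_of_gas : GASᵇᵍ∘ v2 → BGFORMᵃ∘ v2`), this seat's ✓`…CellAnalyticKnit`
(`backgroundFormCell_of_analytic : BGFORMᵃ∘ v2 → BGFORM∘ v2`, and its S2β ∕ GRAD∘ compositions through w4-20520 g20's ✓`…CellKnit`):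
* ★★★ `backgroundFormCellAnalytic_of_response : ⟨RESPᵃ∘⟩ → ⟨BGFORMᵃ∘ v2 VERBATIM (letter 221b2a5f)⟩`;
* ★★★ `fluctuationPartSmall_of_response : ⟨RESPᵃ∘⟩ → ⟨S2β registry :412 VERBATIM⟩`;
* ★★★ `oneBondOscillation_of_response : ⟨RESPᵃ∘⟩ → ⟨GRAD∘ VERBATIM⟩`.
So the PATH-B organ S2β is, in `Theorems/`, a three-token consequence of ONE print-shaped hypothesis row RESPᵃ∘ = {analytic cell terms + a KP gas, both holomorphic in the
background registers on a uniform collar; slice letters for the background map's first-order response on the complex one-bond domain; coarse torus geometry (d1)–(d6)}.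

HONEST SCOPE.  Compositions only; RESPᵃ∘ ∕ GASᵇᵍ∘ v2 ∕ BGFORMᵃ∘ v2 ∕ BGFORM∘ v2 are HYPOTHESIS schemas — nothing of Bałaban's is asserted or proved; (r1)'s volume-uniformity
(critic #496b ∕ FL-15′) untouched; S2β ∕ GRAD∘ ∕ the five registered ∘-stubs (v11.4 0∕5, №36 intact) ∕ `FluctuationComparisonRegPrIntL` (20520) NOT proved; no summit is
proved by a helper; rung R3 = SU(2) YM₃ on T³ — NOT d = 4, NOT infinite volume, NOT a mass gap, NOT Clay.  Sorry-free, axioms standard.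

References: [Balaban1985Variational] CMP 102 (Prop. 9 p.309, (182)–(190) pp.307–308); [Balaban1987RG1] CMP 109 ((0.22)–(0.25) pp.256–257, (1.11)–(1.14) p.262);
[Balaban1988RG2Cluster] CMP 116 ((1.26) p.8, (2.41) p.21); [Balaban1989LargeFieldII] CMP 122 ((1.98)–(1.100) p.390); [Balaban1985UV3] CMP 102 (Thm 2 p.263).
-/

set_option autoImplicit false

noncomputable section

namespace Summit.QuantumFields.YangMills.Theorems.FluctuationComparisonRegPrIntLBackgroundFormCellResponseE2E

open MeasureTheory Filter Topology Set
open scoped BigOperators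
open Literature.MathematicalPhysics.QuantumFieldTheory.Balaban1983to89
open Literature.MathematicalPhysics.QuantumFieldTheory.Balaban1983to89.T3ContinuumYM3Torus T3NestedUnitLaws T3UnitLawDensityEML T3UnitScaleTilt T3TiltDescent
  T3PrintedRegularMinimiser T3LevelShift Missing T4Continuum
open Literature.MathematicalPhysics.QuantumFieldTheory.Balaban1983to89.TreeLengthTorus (TPt TDom IsTDom tsys TFaceConnected torusTreeLen)
open Literature.MathematicalPhysics.QuantumFieldTheory.Balaban1983to89.TreeLengthTorusGeometry (TTouch tgeometry)
open Literature.MathematicalPhysics.QuantumFieldTheory.Balaban1983to89.B12TreeDecay (kappa₀ K₀)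
open Literature.MathematicalPhysics.QuantumFieldTheory.Balaban1983to89.B12Decay510Torus (pl1 tcubeOf)
open Literature.Probability.LatticeModels
open Summit.QuantumFields.YangMills.Theorems.FluctuationComparisonRegPrIntLBackgroundFormCellResponseKnit
open Summit.QuantumFields.YangMills.Theorems.FluctuationComparisonRegPrIntLBackgroundFormCellGasKnit
open Summit.QuantumFields.YangMills.Theorems.FluctuationComparisonRegPrIntLBackgroundFormCellAnalyticKnit

open Classical in
/-- ★★★ **RESPᵃ∘ → BGFORMᵃ∘ v2** (hypothesis = this seat's RESPᵃ∘, HOME `ym-ust-20520-w5/g20/TEXT-RESPa-gas-v2.w5g20.lean`; conclusion = BGFORMᵃ∘ v2 v1.1 letter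
221b2a5fa5f0aca3 VERBATIM): `backgroundFormCellAnalytic_of_gas ∘ backgroundFormCellGas_of_response`.
[cite: Balaban1985Variational, Prop. 9 p.309 and (182)-(190) pp.307-308; Balaban1987RG1, (0.22)-(0.25) pp.256-257 and (1.11)-(1.14) p.262; Balaban1988RG2Cluster, (2.41) p.21] -/
theorem backgroundFormCellAnalytic_of_response
    (hR :
        ∀ (L : ℕ), ∃ pS : ℝ, ∀ (b₀ p₀ : ℝ), 0 < b₀ → pS ≤ p₀ → 0 < p₀ → ∃ ε₁ : ℝ, 0 < ε₁ ∧ ∀ (ε₀ : ℝ), 0 < ε₀ → ε₀ ≤ ε₁ →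
          ∃ γ₁ : ℝ, 0 < γ₁ ∧ ∃ (κ μ C As Ag R r₁ Rₐ Rw : ℝ) (Mc : ℕ) (_ : NeZero Mc), 0 < κ ∧ 0 ≤ μ ∧ 0 ≤ As ∧ 0 ≤ Ag ∧ 0 < Rₐ ∧ 1 < Rw ∧
            2 * kappa₀ (4 * 2 ^ 3) (2 * 3) ≤ r₁ ∧ r₁ + 2 * kappa₀ (4 * 2 ^ 3) (2 * 3) + 2 ≤ R ∧
            Ag * Real.exp (5 * r₁ + 1) * K₀ (4 * 2 ^ 3) (2 * 3) * 7 * 32 ≤ 1 ∧ ∀ (F : T3Family) (γ : ℝ), F.L = L → 0 < γ → γ ≤ γ₁ →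
            ∃ (σ : ℕ → ℝ), (∀ J, 0 ≤ σ J) ∧
              (∀ a : ℕ, Tendsto (fun J : ℕ => ((J : ℝ) + 1) ^ a * σ J) atTop (𝓝 0)) ∧
              ∀ (ν : ℕ → (j : ℕ) → Measure (GaugeField (F.P j) 0 (Matrix.specialUnitaryGroup (Fin 2) ℂ))),
                (∀ K, ν K K = T4GenFunBounds.gibbsMeasure (F.P K) ((F.scheme ℰp γ).β K)) →
                (∀ K j, j < K → ν K j = Measure.map (descend F ℰp j) (ν K (j + 1))) →
                ∀ (J K : ℕ) (hJK : J ≤ K) (ρ : GaugeField (F.P J) 0 (Matrix.specialUnitaryGroup (Fin 2) ℂ) → ℝ),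
                  (∀ U, PlaqSmall (θBal F.L γ b₀ p₀ J) U → 0 < ρ U) →
                  ν K J = (fieldMeasure _ _ _).withDensity (fun U => ENNReal.ofReal (ρ U)) →
                  ContinuousOn ρ {U | PlaqSmall (θBal F.L γ b₀ p₀ J) U} →
                  ∃ (c₀ : ℝ) (d : PBond (F.P J) 0 → PBond (F.P J) 0 → ℝ) (blk : PBond (F.P K) 0 → PBond (F.P J) 0)
                    (M : GaugeField (F.P J) 0 (Matrix.specialUnitaryGroup (Fin 2) ℂ) → PBond (F.P K) 0 → (Fin 8 → ℝ))
                    (Ncb : ℕ) (_ : NeZero Ncb) (ecb : PBond (F.P J) 0 → TPt 3 (Ncb * Mc))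
                    (D : PBond (F.P K) 0 → Set (Fin 8 → ℂ))
                    (𝒮 : Finset (TPt 3 Ncb) → (PBond (F.P K) 0 → (Fin 8 → ℂ)) → ℂ)
                    (act : TDom 3 Ncb → (PBond (F.P K) 0 → (Fin 8 → ℂ)) → ℂ),
                    (∀ x y, 0 ≤ d x y) ∧ (∀ x y, d x y = d y x) ∧ (∀ x y z, d x z ≤ d x y + d y z) ∧
                    (∀ x, ∑ y, Real.exp (-(μ * d x y)) ≤ C) ∧
                    (∀ b b' : PBond (F.P J) 0, κ * (b.src.tdist b'.src : ℝ) ≤ μ * d b b') ∧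
                    (∀ c c' : PBond (F.P J) 0, 2 * μ * d c c' ≤ (r₁ / 2 / ((Mc : ℝ) * 3)) * pl1 (ecb c - ecb c')) ∧
                    (∀ e, IsOpen (D e)) ∧
                    (∀ (U : GaugeField (F.P J) 0 (Matrix.specialUnitaryGroup (Fin 2) ℂ)), PlaqSmall (θBal F.L γ b₀ p₀ J) U →
                        ∀ e, Metric.ball (fun (i : Fin 8) => (M U e i : ℂ)) (2 * Rₐ) ⊆ D e) ∧
                    (∀ (Y : Finset (TPt 3 Ncb)) (q q' : PBond (F.P K) 0 → (Fin 8 → ℂ)),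
                        (∀ e, tcubeOf Ncb Mc (ecb (blk e)) ∈ Y → q e = q' e) → 𝒮 Y q = 𝒮 Y q') ∧
                    (∀ Y : Finset (TPt 3 Ncb), ¬ TFaceConnected Y → ∀ q, 𝒮 Y q = 0) ∧
                    (∀ Y, DifferentiableOn ℂ (𝒮 Y) {q | ∀ e, q e ∈ D e}) ∧
                    (∀ Y, ∀ q ∈ {q : PBond (F.P K) 0 → (Fin 8 → ℂ) | ∀ e, q e ∈ D e}, ‖𝒮 Y q‖ ≤ As * Real.exp (-r₁ * torusTreeLen Y)) ∧
                    (∀ (Z : TDom 3 Ncb) (q q' : PBond (F.P K) 0 → (Fin 8 → ℂ)),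
                        (∀ e, tcubeOf Ncb Mc (ecb (blk e)) ∈ Z.1 → q e = q' e) → act Z q = act Z q') ∧
                    (∀ Z, DifferentiableOn ℂ (act Z) {q | ∀ e, q e ∈ D e}) ∧
                    (∀ Z, ∀ q ∈ {q : PBond (F.P K) 0 → (Fin 8 → ℂ) | ∀ e, q e ∈ D e}, ‖act Z q‖ ≤ Ag * Real.exp (-(R * torusTreeLen Z.1))) ∧
                    (∀ (U : GaugeField (F.P J) 0 (Matrix.specialUnitaryGroup (Fin 2) ℂ)), PlaqSmall (θBal F.L γ b₀ p₀ J) U →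
                        ∀ Z, (act Z (fun e (i : Fin 8) => (M U e i : ℂ))).im = 0) ∧
                    (∀ (b b' : PBond (F.P J) 0) (U V W Z : GaugeField (F.P J) 0 (Matrix.specialUnitaryGroup (Fin 2) ℂ)),
                        PlaqSmall (θBal F.L γ b₀ p₀ J) U → PlaqSmall (θBal F.L γ b₀ p₀ J) V →
                        PlaqSmall (θBal F.L γ b₀ p₀ J) W → PlaqSmall (θBal F.L γ b₀ p₀ J) Z →
                        (∀ e, e ≠ b → U e = V e) → (∀ e, e ≠ b' → U e = W e) → (∀ e, e ≠ b' → V e = Z e) → (∀ e, e ≠ b → W e = Z e) →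
                        ∀ e : PBond (F.P K) 0, ∃ g : ℂ → ℂ → (Fin 8 → ℂ),
                          g 0 0 = (fun i => (M Z e i : ℂ)) ∧ g 1 0 = (fun i => (M W e i : ℂ)) ∧
                          g 0 1 = (fun i => (M V e i : ℂ)) ∧ g 1 1 = (fun i => (M U e i : ℂ)) ∧
                          DifferentiableOn ℂ (fun z => g z 1 - g z 0) (Metric.ball 0 Rw) ∧
                          (∀ z ∈ Metric.ball (0 : ℂ) Rw, ‖g z 1 - g z 0‖ ≤ σ J * Real.exp (-(4 * μ * d (blk e) b'))) ∧
                          DifferentiableOn ℂ (fun w => g 1 w - g 0 w) (Metric.ball 0 Rw) ∧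
                          (∀ w ∈ Metric.ball (0 : ℂ) Rw, ‖g 1 w - g 0 w‖ ≤ σ J * Real.exp (-(4 * μ * d b (blk e))))) ∧
                    (∀ U : GaugeField (F.P J) 0 (Matrix.specialUnitaryGroup (Fin 2) ℂ), PlaqSmall (θBal F.L γ b₀ p₀ J) U →
                        Real.log (ρ U) + (F.scheme ℰp γ).β K * minActionRegPr F J K hJK ε₀ U =
                          c₀ + ∑ Y, (𝒮 Y (fun e (i : Fin 8) => (M U e i : ℂ))).re +
                            Real.log (polymerPartitionFunction TTouch (fun Z : TDom 3 Ncb => act Z (fun e (i : Fin 8) => (M U e i : ℂ))) Finset.univ).re)) :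
      ∀ (L : ℕ), ∃ pS : ℝ, ∀ (b₀ p₀ : ℝ), 0 < b₀ → pS ≤ p₀ → 0 < p₀ → ∃ ε₁ : ℝ, 0 < ε₁ ∧ ∀ (ε₀ : ℝ), 0 < ε₀ → ε₀ ≤ ε₁ →
        ∃ γ₁ : ℝ, 0 < γ₁ ∧ ∃ (κ μ C A Hc Rₐ : ℝ), 0 < κ ∧ 0 ≤ μ ∧ 0 ≤ A ∧ 0 ≤ Hc ∧ 0 < Rₐ ∧ ∀ (F : T3Family) (γ : ℝ), F.L = L → 0 < γ → γ ≤ γ₁ →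
          ∃ (σ σ₂ : ℕ → ℝ), (∀ J, 0 ≤ σ J) ∧ (∀ J, 0 ≤ σ₂ J) ∧
            (∀ a : ℕ, Tendsto (fun J : ℕ => ((J : ℝ) + 1) ^ a * σ J) atTop (𝓝 0)) ∧
            (∀ a : ℕ, Tendsto (fun J : ℕ => ((J : ℝ) + 1) ^ a * σ₂ J) atTop (𝓝 0)) ∧
            ∀ (ν : ℕ → (j : ℕ) → Measure (GaugeField (F.P j) 0 (Matrix.specialUnitaryGroup (Fin 2) ℂ))),
              (∀ K, ν K K = T4GenFunBounds.gibbsMeasure (F.P K) ((F.scheme ℰp γ).β K)) →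
              (∀ K j, j < K → ν K j = Measure.map (descend F ℰp j) (ν K (j + 1))) →
              ∀ (J K : ℕ) (hJK : J ≤ K) (ρ : GaugeField (F.P J) 0 (Matrix.specialUnitaryGroup (Fin 2) ℂ) → ℝ),
                (∀ U, PlaqSmall (θBal F.L γ b₀ p₀ J) U → 0 < ρ U) →
                ν K J = (fieldMeasure _ _ _).withDensity (fun U => ENNReal.ofReal (ρ U)) →
                ContinuousOn ρ {U | PlaqSmall (θBal F.L γ b₀ p₀ J) U} →
                ∃ (c₀ : ℝ) (d : PBond (F.P J) 0 → PBond (F.P J) 0 → ℝ) (blk : PBond (F.P K) 0 → PBond (F.P J) 0)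
                  (M : GaugeField (F.P J) 0 (Matrix.specialUnitaryGroup (Fin 2) ℂ) → PBond (F.P K) 0 → (Fin 8 → ℝ))
                  (𝒯 : (X : Finset (PBond (F.P J) 0)) → (({e : PBond (F.P K) 0 // blk e ∈ X} → (Fin 8 → ℂ)) → ℂ))
                  (Dom : (X : Finset (PBond (F.P J) 0)) → Set ({e : PBond (F.P K) 0 // blk e ∈ X} → (Fin 8 → ℂ)))
                  (Bx : Finset (PBond (F.P J) 0) → ℝ),
                  (∀ x y, 0 ≤ d x y) ∧ (∀ x y, d x y = d y x) ∧ (∀ x y z, d x z ≤ d x y + d y z) ∧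
                  (∀ x, ∑ y, Real.exp (-(μ * d x y)) ≤ C) ∧
                  (∀ b b' : PBond (F.P J) 0, κ * (b.src.tdist b'.src : ℝ) ≤ μ * d b b') ∧
                  (∀ X, 0 ≤ Bx X) ∧
                  (∀ c, ∑ X ∈ Finset.univ.filter (fun X => c ∈ X), Bx X ≤ A) ∧
                  (∀ c c', ∑ X ∈ Finset.univ.filter (fun X => c ∈ X ∧ c' ∈ X), Bx X ≤ Hc * Real.exp (-(2 * μ * d c c'))) ∧
                  (∀ X, IsOpen (Dom X)) ∧ (∀ X, DifferentiableOn ℂ (𝒯 X) (Dom X)) ∧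
                  (∀ X, ∀ p ∈ Dom X, ‖𝒯 X p‖ ≤ Bx X) ∧
                  (∀ (X : Finset (PBond (F.P J) 0)) (U : GaugeField (F.P J) 0 (Matrix.specialUnitaryGroup (Fin 2) ℂ)),
                      PlaqSmall (θBal F.L γ b₀ p₀ J) U →
                      Metric.ball (fun (e : {e : PBond (F.P K) 0 // blk e ∈ X}) (i : Fin 8) => (M U e.1 i : ℂ)) (2 * Rₐ) ⊆ Dom X) ∧
                  (∀ (b : PBond (F.P J) 0) (U V : GaugeField (F.P J) 0 (Matrix.specialUnitaryGroup (Fin 2) ℂ)),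
                      PlaqSmall (θBal F.L γ b₀ p₀ J) U → PlaqSmall (θBal F.L γ b₀ p₀ J) V → (∀ e, e ≠ b → U e = V e) →
                      ∀ e, ‖M U e - M V e‖ ≤ σ J * Real.exp (-(2 * μ * d b (blk e)))) ∧
                  (∀ (b b' : PBond (F.P J) 0) (U V W Z : GaugeField (F.P J) 0 (Matrix.specialUnitaryGroup (Fin 2) ℂ)),
                      PlaqSmall (θBal F.L γ b₀ p₀ J) U → PlaqSmall (θBal F.L γ b₀ p₀ J) V →
                      PlaqSmall (θBal F.L γ b₀ p₀ J) W → PlaqSmall (θBal F.L γ b₀ p₀ J) Z →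
                      (∀ e, e ≠ b → U e = V e) → (∀ e, e ≠ b' → U e = W e) → (∀ e, e ≠ b' → V e = Z e) → (∀ e, e ≠ b → W e = Z e) →
                      ∀ e, ‖M U e - M W e - M V e + M Z e‖ ≤
                        σ₂ J * (Real.exp (-(2 * μ * d b (blk e))) * Real.exp (-(2 * μ * d (blk e) b')))) ∧
                  (∀ U : GaugeField (F.P J) 0 (Matrix.specialUnitaryGroup (Fin 2) ℂ), PlaqSmall (θBal F.L γ b₀ p₀ J) U →
                      Real.log (ρ U) + (F.scheme ℰp γ).β K * minActionRegPr F J K hJK ε₀ U = c₀ + ∑ X, (𝒯 X (fun (e : {e : PBond (F.P K) 0 // blk e ∈ X}) (i : Fin 8) => (M U e.1 i : ℂ))).re) :=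
  backgroundFormCellAnalytic_of_gas (backgroundFormCellGas_of_response hR)

open Classical in
/-- ★★★ **RESPᵃ∘ → S2β** (conclusion = registry `Lines/semiclassical_s2beta.lean` v11.4 :412 VERBATIM, ws-sha16 e30624f0b884478a): three-token composition.
[cite: Balaban1985UV3, Thm 2 p.263 and (41) p.266; Balaban1985Variational, Prop. 9 p.309; Balaban1987RG1, (0.25) p.257; Balaban1989LargeFieldII, (1.98)-(1.100) p.390] -/
theorem fluctuationPartSmall_of_response
    (hR :
        ∀ (L : ℕ), ∃ pS : ℝ, ∀ (b₀ p₀ : ℝ), 0 < b₀ → pS ≤ p₀ → 0 < p₀ → ∃ ε₁ : ℝ, 0 < ε₁ ∧ ∀ (ε₀ : ℝ), 0 < ε₀ → ε₀ ≤ ε₁ →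
          ∃ γ₁ : ℝ, 0 < γ₁ ∧ ∃ (κ μ C As Ag R r₁ Rₐ Rw : ℝ) (Mc : ℕ) (_ : NeZero Mc), 0 < κ ∧ 0 ≤ μ ∧ 0 ≤ As ∧ 0 ≤ Ag ∧ 0 < Rₐ ∧ 1 < Rw ∧
            2 * kappa₀ (4 * 2 ^ 3) (2 * 3) ≤ r₁ ∧ r₁ + 2 * kappa₀ (4 * 2 ^ 3) (2 * 3) + 2 ≤ R ∧
            Ag * Real.exp (5 * r₁ + 1) * K₀ (4 * 2 ^ 3) (2 * 3) * 7 * 32 ≤ 1 ∧ ∀ (F : T3Family) (γ : ℝ), F.L = L → 0 < γ → γ ≤ γ₁ →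
            ∃ (σ : ℕ → ℝ), (∀ J, 0 ≤ σ J) ∧
              (∀ a : ℕ, Tendsto (fun J : ℕ => ((J : ℝ) + 1) ^ a * σ J) atTop (𝓝 0)) ∧
              ∀ (ν : ℕ → (j : ℕ) → Measure (GaugeField (F.P j) 0 (Matrix.specialUnitaryGroup (Fin 2) ℂ))),
                (∀ K, ν K K = T4GenFunBounds.gibbsMeasure (F.P K) ((F.scheme ℰp γ).β K)) →
                (∀ K j, j < K → ν K j = Measure.map (descend F ℰp j) (ν K (j + 1))) →
                ∀ (J K : ℕ) (hJK : J ≤ K) (ρ : GaugeField (F.P J) 0 (Matrix.specialUnitaryGroup (Fin 2) ℂ) → ℝ),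
                  (∀ U, PlaqSmall (θBal F.L γ b₀ p₀ J) U → 0 < ρ U) →
                  ν K J = (fieldMeasure _ _ _).withDensity (fun U => ENNReal.ofReal (ρ U)) →
                  ContinuousOn ρ {U | PlaqSmall (θBal F.L γ b₀ p₀ J) U} →
                  ∃ (c₀ : ℝ) (d : PBond (F.P J) 0 → PBond (F.P J) 0 → ℝ) (blk : PBond (F.P K) 0 → PBond (F.P J) 0)
                    (M : GaugeField (F.P J) 0 (Matrix.specialUnitaryGroup (Fin 2) ℂ) → PBond (F.P K) 0 → (Fin 8 → ℝ))
                    (Ncb : ℕ) (_ : NeZero Ncb) (ecb : PBond (F.P J) 0 → TPt 3 (Ncb * Mc))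
                    (D : PBond (F.P K) 0 → Set (Fin 8 → ℂ))
                    (𝒮 : Finset (TPt 3 Ncb) → (PBond (F.P K) 0 → (Fin 8 → ℂ)) → ℂ)
                    (act : TDom 3 Ncb → (PBond (F.P K) 0 → (Fin 8 → ℂ)) → ℂ),
                    (∀ x y, 0 ≤ d x y) ∧ (∀ x y, d x y = d y x) ∧ (∀ x y z, d x z ≤ d x y + d y z) ∧
                    (∀ x, ∑ y, Real.exp (-(μ * d x y)) ≤ C) ∧
                    (∀ b b' : PBond (F.P J) 0, κ * (b.src.tdist b'.src : ℝ) ≤ μ * d b b') ∧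
                    (∀ c c' : PBond (F.P J) 0, 2 * μ * d c c' ≤ (r₁ / 2 / ((Mc : ℝ) * 3)) * pl1 (ecb c - ecb c')) ∧
                    (∀ e, IsOpen (D e)) ∧
                    (∀ (U : GaugeField (F.P J) 0 (Matrix.specialUnitaryGroup (Fin 2) ℂ)), PlaqSmall (θBal F.L γ b₀ p₀ J) U →
                        ∀ e, Metric.ball (fun (i : Fin 8) => (M U e i : ℂ)) (2 * Rₐ) ⊆ D e) ∧
                    (∀ (Y : Finset (TPt 3 Ncb)) (q q' : PBond (F.P K) 0 → (Fin 8 → ℂ)),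
                        (∀ e, tcubeOf Ncb Mc (ecb (blk e)) ∈ Y → q e = q' e) → 𝒮 Y q = 𝒮 Y q') ∧
                    (∀ Y : Finset (TPt 3 Ncb), ¬ TFaceConnected Y → ∀ q, 𝒮 Y q = 0) ∧
                    (∀ Y, DifferentiableOn ℂ (𝒮 Y) {q | ∀ e, q e ∈ D e}) ∧
                    (∀ Y, ∀ q ∈ {q : PBond (F.P K) 0 → (Fin 8 → ℂ) | ∀ e, q e ∈ D e}, ‖𝒮 Y q‖ ≤ As * Real.exp (-r₁ * torusTreeLen Y)) ∧
                    (∀ (Z : TDom 3 Ncb) (q q' : PBond (F.P K) 0 → (Fin 8 → ℂ)),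
                        (∀ e, tcubeOf Ncb Mc (ecb (blk e)) ∈ Z.1 → q e = q' e) → act Z q = act Z q') ∧
                    (∀ Z, DifferentiableOn ℂ (act Z) {q | ∀ e, q e ∈ D e}) ∧
                    (∀ Z, ∀ q ∈ {q : PBond (F.P K) 0 → (Fin 8 → ℂ) | ∀ e, q e ∈ D e}, ‖act Z q‖ ≤ Ag * Real.exp (-(R * torusTreeLen Z.1))) ∧
                    (∀ (U : GaugeField (F.P J) 0 (Matrix.specialUnitaryGroup (Fin 2) ℂ)), PlaqSmall (θBal F.L γ b₀ p₀ J) U →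
                        ∀ Z, (act Z (fun e (i : Fin 8) => (M U e i : ℂ))).im = 0) ∧
                    (∀ (b b' : PBond (F.P J) 0) (U V W Z : GaugeField (F.P J) 0 (Matrix.specialUnitaryGroup (Fin 2) ℂ)),
                        PlaqSmall (θBal F.L γ b₀ p₀ J) U → PlaqSmall (θBal F.L γ b₀ p₀ J) V →
                        PlaqSmall (θBal F.L γ b₀ p₀ J) W → PlaqSmall (θBal F.L γ b₀ p₀ J) Z →
                        (∀ e, e ≠ b → U e = V e) → (∀ e, e ≠ b' → U e = W e) → (∀ e, e ≠ b' → V e = Z e) → (∀ e, e ≠ b → W e = Z e) →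
                        ∀ e : PBond (F.P K) 0, ∃ g : ℂ → ℂ → (Fin 8 → ℂ),
                          g 0 0 = (fun i => (M Z e i : ℂ)) ∧ g 1 0 = (fun i => (M W e i : ℂ)) ∧
                          g 0 1 = (fun i => (M V e i : ℂ)) ∧ g 1 1 = (fun i => (M U e i : ℂ)) ∧
                          DifferentiableOn ℂ (fun z => g z 1 - g z 0) (Metric.ball 0 Rw) ∧
                          (∀ z ∈ Metric.ball (0 : ℂ) Rw, ‖g z 1 - g z 0‖ ≤ σ J * Real.exp (-(4 * μ * d (blk e) b'))) ∧
                          DifferentiableOn ℂ (fun w => g 1 w - g 0 w) (Metric.ball 0 Rw) ∧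
                          (∀ w ∈ Metric.ball (0 : ℂ) Rw, ‖g 1 w - g 0 w‖ ≤ σ J * Real.exp (-(4 * μ * d b (blk e))))) ∧
                    (∀ U : GaugeField (F.P J) 0 (Matrix.specialUnitaryGroup (Fin 2) ℂ), PlaqSmall (θBal F.L γ b₀ p₀ J) U →
                        Real.log (ρ U) + (F.scheme ℰp γ).β K * minActionRegPr F J K hJK ε₀ U =
                          c₀ + ∑ Y, (𝒮 Y (fun e (i : Fin 8) => (M U e i : ℂ))).re +
                            Real.log (polymerPartitionFunction TTouch (fun Z : TDom 3 Ncb => act Z (fun e (i : Fin 8) => (M U e i : ℂ))) Finset.univ).re)) :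
      ∀ (L : ℕ), ∃ pS : ℝ, ∀ (b₀ p₀ : ℝ), 0 < b₀ → pS ≤ p₀ → 0 < p₀ → ∃ ε₁ : ℝ, 0 < ε₁ ∧ ∀ (ε₀ : ℝ), 0 < ε₀ → ε₀ ≤ ε₁ →
        ∃ γ₁ : ℝ, 0 < γ₁ ∧ ∃ κ : ℝ, 0 < κ ∧ ∀ (F : T3Family) (γ : ℝ), F.L = L → 0 < γ → γ ≤ γ₁ →
          ∃ (φ : ℕ → ℝ), (∀ J, 0 ≤ φ J) ∧ Tendsto (fun J : ℕ => (J : ℝ) * φ J) atTop (𝓝 0) ∧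
            ∀ (ν : ℕ → (j : ℕ) → Measure (GaugeField (F.P j) 0 (Matrix.specialUnitaryGroup (Fin 2) ℂ))),
              (∀ K, ν K K = T4GenFunBounds.gibbsMeasure (F.P K) ((F.scheme ℰp γ).β K)) →
              (∀ K j, j < K → ν K j = Measure.map (descend F ℰp j) (ν K (j + 1))) →
              ∀ (J K : ℕ) (hJK : J ≤ K) (ρ : GaugeField (F.P J) 0 (Matrix.specialUnitaryGroup (Fin 2) ℂ) → ℝ),
                (∀ U, PlaqSmall (θBal F.L γ b₀ p₀ J) U → 0 < ρ U) →
                ν K J = (fieldMeasure _ _ _).withDensity (fun U => ENNReal.ofReal (ρ U)) →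
                ContinuousOn ρ {U | PlaqSmall (θBal F.L γ b₀ p₀ J) U} →
                ∀ (b b' : PBond (F.P J) 0) (U V W Z : GaugeField (F.P J) 0 (Matrix.specialUnitaryGroup (Fin 2) ℂ)),
                  PlaqSmall (θBal F.L γ b₀ p₀ J) U → PlaqSmall (θBal F.L γ b₀ p₀ J) V →
                  PlaqSmall (θBal F.L γ b₀ p₀ J) W → PlaqSmall (θBal F.L γ b₀ p₀ J) Z →
                  (∀ e, e ≠ b → U e = V e) → (∀ e, e ≠ b' → U e = W e) → (∀ e, e ≠ b' → V e = Z e) → (∀ e, e ≠ b → W e = Z e) →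
                  |((Real.log (ρ U) + (F.scheme ℰp γ).β K * minActionRegPr F J K hJK ε₀ U)
                      - (Real.log (ρ V) + (F.scheme ℰp γ).β K * minActionRegPr F J K hJK ε₀ V))
                    - ((Real.log (ρ W) + (F.scheme ℰp γ).β K * minActionRegPr F J K hJK ε₀ W)
                      - (Real.log (ρ Z) + (F.scheme ℰp γ).β K * minActionRegPr F J K hJK ε₀ Z))|
                    ≤ φ J * Real.exp (-(κ * (b.src.tdist b'.src : ℝ))) :=
  fluctuationPartSmall_of_backgroundFormCellAnalytic (backgroundFormCellAnalytic_of_gas (backgroundFormCellGas_of_response hR))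

open Classical in
/-- ★★★ **RESPᵃ∘ → GRAD∘** (conclusion = LINE g24-1 `Lines/gradient_split.lean` §0 VERBATIM): three-token composition.
[cite: Balaban1987RG1, Thm 1 (0.24)-(0.25) p.257; Balaban1985Variational, Prop. 9 p.309; Balaban1989LargeFieldII, (1.98)-(1.100) p.390] -/
theorem oneBondOscillation_of_response
    (hR :
        ∀ (L : ℕ), ∃ pS : ℝ, ∀ (b₀ p₀ : ℝ), 0 < b₀ → pS ≤ p₀ → 0 < p₀ → ∃ ε₁ : ℝ, 0 < ε₁ ∧ ∀ (ε₀ : ℝ), 0 < ε₀ → ε₀ ≤ ε₁ →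
          ∃ γ₁ : ℝ, 0 < γ₁ ∧ ∃ (κ μ C As Ag R r₁ Rₐ Rw : ℝ) (Mc : ℕ) (_ : NeZero Mc), 0 < κ ∧ 0 ≤ μ ∧ 0 ≤ As ∧ 0 ≤ Ag ∧ 0 < Rₐ ∧ 1 < Rw ∧
            2 * kappa₀ (4 * 2 ^ 3) (2 * 3) ≤ r₁ ∧ r₁ + 2 * kappa₀ (4 * 2 ^ 3) (2 * 3) + 2 ≤ R ∧
            Ag * Real.exp (5 * r₁ + 1) * K₀ (4 * 2 ^ 3) (2 * 3) * 7 * 32 ≤ 1 ∧ ∀ (F : T3Family) (γ : ℝ), F.L = L → 0 < γ → γ ≤ γ₁ →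
            ∃ (σ : ℕ → ℝ), (∀ J, 0 ≤ σ J) ∧
              (∀ a : ℕ, Tendsto (fun J : ℕ => ((J : ℝ) + 1) ^ a * σ J) atTop (𝓝 0)) ∧
              ∀ (ν : ℕ → (j : ℕ) → Measure (GaugeField (F.P j) 0 (Matrix.specialUnitaryGroup (Fin 2) ℂ))),
                (∀ K, ν K K = T4GenFunBounds.gibbsMeasure (F.P K) ((F.scheme ℰp γ).β K)) →
                (∀ K j, j < K → ν K j = Measure.map (descend F ℰp j) (ν K (j + 1))) →
                ∀ (J K : ℕ) (hJK : J ≤ K) (ρ : GaugeField (F.P J) 0 (Matrix.specialUnitaryGroup (Fin 2) ℂ) → ℝ),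
                  (∀ U, PlaqSmall (θBal F.L γ b₀ p₀ J) U → 0 < ρ U) →
                  ν K J = (fieldMeasure _ _ _).withDensity (fun U => ENNReal.ofReal (ρ U)) →
                  ContinuousOn ρ {U | PlaqSmall (θBal F.L γ b₀ p₀ J) U} →
                  ∃ (c₀ : ℝ) (d : PBond (F.P J) 0 → PBond (F.P J) 0 → ℝ) (blk : PBond (F.P K) 0 → PBond (F.P J) 0)
                    (M : GaugeField (F.P J) 0 (Matrix.specialUnitaryGroup (Fin 2) ℂ) → PBond (F.P K) 0 → (Fin 8 → ℝ))
                    (Ncb : ℕ) (_ : NeZero Ncb) (ecb : PBond (F.P J) 0 → TPt 3 (Ncb * Mc))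
                    (D : PBond (F.P K) 0 → Set (Fin 8 → ℂ))
                    (𝒮 : Finset (TPt 3 Ncb) → (PBond (F.P K) 0 → (Fin 8 → ℂ)) → ℂ)
                    (act : TDom 3 Ncb → (PBond (F.P K) 0 → (Fin 8 → ℂ)) → ℂ),
                    (∀ x y, 0 ≤ d x y) ∧ (∀ x y, d x y = d y x) ∧ (∀ x y z, d x z ≤ d x y + d y z) ∧
                    (∀ x, ∑ y, Real.exp (-(μ * d x y)) ≤ C) ∧
                    (∀ b b' : PBond (F.P J) 0, κ * (b.src.tdist b'.src : ℝ) ≤ μ * d b b') ∧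
                    (∀ c c' : PBond (F.P J) 0, 2 * μ * d c c' ≤ (r₁ / 2 / ((Mc : ℝ) * 3)) * pl1 (ecb c - ecb c')) ∧
                    (∀ e, IsOpen (D e)) ∧
                    (∀ (U : GaugeField (F.P J) 0 (Matrix.specialUnitaryGroup (Fin 2) ℂ)), PlaqSmall (θBal F.L γ b₀ p₀ J) U →
                        ∀ e, Metric.ball (fun (i : Fin 8) => (M U e i : ℂ)) (2 * Rₐ) ⊆ D e) ∧
                    (∀ (Y : Finset (TPt 3 Ncb)) (q q' : PBond (F.P K) 0 → (Fin 8 → ℂ)),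
                        (∀ e, tcubeOf Ncb Mc (ecb (blk e)) ∈ Y → q e = q' e) → 𝒮 Y q = 𝒮 Y q') ∧
                    (∀ Y : Finset (TPt 3 Ncb), ¬ TFaceConnected Y → ∀ q, 𝒮 Y q = 0) ∧
                    (∀ Y, DifferentiableOn ℂ (𝒮 Y) {q | ∀ e, q e ∈ D e}) ∧
                    (∀ Y, ∀ q ∈ {q : PBond (F.P K) 0 → (Fin 8 → ℂ) | ∀ e, q e ∈ D e}, ‖𝒮 Y q‖ ≤ As * Real.exp (-r₁ * torusTreeLen Y)) ∧
                    (∀ (Z : TDom 3 Ncb) (q q' : PBond (F.P K) 0 → (Fin 8 → ℂ)),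
                        (∀ e, tcubeOf Ncb Mc (ecb (blk e)) ∈ Z.1 → q e = q' e) → act Z q = act Z q') ∧
                    (∀ Z, DifferentiableOn ℂ (act Z) {q | ∀ e, q e ∈ D e}) ∧
                    (∀ Z, ∀ q ∈ {q : PBond (F.P K) 0 → (Fin 8 → ℂ) | ∀ e, q e ∈ D e}, ‖act Z q‖ ≤ Ag * Real.exp (-(R * torusTreeLen Z.1))) ∧
                    (∀ (U : GaugeField (F.P J) 0 (Matrix.specialUnitaryGroup (Fin 2) ℂ)), PlaqSmall (θBal F.L γ b₀ p₀ J) U →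
                        ∀ Z, (act Z (fun e (i : Fin 8) => (M U e i : ℂ))).im = 0) ∧
                    (∀ (b b' : PBond (F.P J) 0) (U V W Z : GaugeField (F.P J) 0 (Matrix.specialUnitaryGroup (Fin 2) ℂ)),
                        PlaqSmall (θBal F.L γ b₀ p₀ J) U → PlaqSmall (θBal F.L γ b₀ p₀ J) V →
                        PlaqSmall (θBal F.L γ b₀ p₀ J) W → PlaqSmall (θBal F.L γ b₀ p₀ J) Z →
                        (∀ e, e ≠ b → U e = V e) → (∀ e, e ≠ b' → U e = W e) → (∀ e, e ≠ b' → V e = Z e) → (∀ e, e ≠ b → W e = Z e) →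
                        ∀ e : PBond (F.P K) 0, ∃ g : ℂ → ℂ → (Fin 8 → ℂ),
                          g 0 0 = (fun i => (M Z e i : ℂ)) ∧ g 1 0 = (fun i => (M W e i : ℂ)) ∧
                          g 0 1 = (fun i => (M V e i : ℂ)) ∧ g 1 1 = (fun i => (M U e i : ℂ)) ∧
                          DifferentiableOn ℂ (fun z => g z 1 - g z 0) (Metric.ball 0 Rw) ∧
                          (∀ z ∈ Metric.ball (0 : ℂ) Rw, ‖g z 1 - g z 0‖ ≤ σ J * Real.exp (-(4 * μ * d (blk e) b'))) ∧
                          DifferentiableOn ℂ (fun w => g 1 w - g 0 w) (Metric.ball 0 Rw) ∧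
                          (∀ w ∈ Metric.ball (0 : ℂ) Rw, ‖g 1 w - g 0 w‖ ≤ σ J * Real.exp (-(4 * μ * d b (blk e))))) ∧
                    (∀ U : GaugeField (F.P J) 0 (Matrix.specialUnitaryGroup (Fin 2) ℂ), PlaqSmall (θBal F.L γ b₀ p₀ J) U →
                        Real.log (ρ U) + (F.scheme ℰp γ).β K * minActionRegPr F J K hJK ε₀ U =
                          c₀ + ∑ Y, (𝒮 Y (fun e (i : Fin 8) => (M U e i : ℂ))).re +
                            Real.log (polymerPartitionFunction TTouch (fun Z : TDom 3 Ncb => act Z (fun e (i : Fin 8) => (M U e i : ℂ))) Finset.univ).re)) :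
      ∀ (L : ℕ), ∃ pS : ℝ, ∀ (b₀ p₀ : ℝ), 0 < b₀ → pS ≤ p₀ → 0 < p₀ → ∃ ε₁ : ℝ, 0 < ε₁ ∧ ∀ (ε₀ : ℝ), 0 < ε₀ → ε₀ ≤ ε₁ →
        ∃ γ₁ : ℝ, 0 < γ₁ ∧ ∀ (F : T3Family) (γ : ℝ), F.L = L → 0 < γ → γ ≤ γ₁ →
          ∃ (σ : ℕ → ℝ), (∀ J, 0 ≤ σ J) ∧ (∀ a : ℕ, Tendsto (fun J : ℕ => ((J : ℝ) + 1) ^ a * σ J) atTop (𝓝 0)) ∧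
            ∀ (ν : ℕ → (j : ℕ) → Measure (GaugeField (F.P j) 0 (Matrix.specialUnitaryGroup (Fin 2) ℂ))),
              (∀ K, ν K K = T4GenFunBounds.gibbsMeasure (F.P K) ((F.scheme ℰp γ).β K)) →
              (∀ K j, j < K → ν K j = Measure.map (descend F ℰp j) (ν K (j + 1))) →
              ∀ (J K : ℕ) (hJK : J ≤ K) (ρ : GaugeField (F.P J) 0 (Matrix.specialUnitaryGroup (Fin 2) ℂ) → ℝ),
                (∀ U, PlaqSmall (θBal F.L γ b₀ p₀ J) U → 0 < ρ U) →
                ν K J = (fieldMeasure _ _ _).withDensity (fun U => ENNReal.ofReal (ρ U)) →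
                ContinuousOn ρ {U | PlaqSmall (θBal F.L γ b₀ p₀ J) U} →
                ∀ (b : PBond (F.P J) 0) (U V : GaugeField (F.P J) 0 (Matrix.specialUnitaryGroup (Fin 2) ℂ)),
                  PlaqSmall (θBal F.L γ b₀ p₀ J) U → PlaqSmall (θBal F.L γ b₀ p₀ J) V →
                  (∀ e, e ≠ b → U e = V e) →
                  |(Real.log (ρ U) + (F.scheme ℰp γ).β K * minActionRegPr F J K hJK ε₀ U)
                      - (Real.log (ρ V) + (F.scheme ℰp γ).β K * minActionRegPr F J K hJK ε₀ V)| ≤ σ J :=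
  oneBondOscillation_of_backgroundFormCellAnalytic (backgroundFormCellAnalytic_of_gas (backgroundFormCellGas_of_response hR))

end Summit.QuantumFields.YangMills.Theorems.FluctuationComparisonRegPrIntLBackgroundFormCellResponseE2E
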